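import Literature.Analysis.FluidPDE.KNSSAxisymmetricNoSwirlHolds
import HarnessLib

/-!
# Lei–Zhang–Zhao 2017, Remark 1.4 / Lemma 5.2: the radially decaying swirl (discharge)

Analysis/FluidPDE proof file (everything proved; no definitions, no named facts), sibling of
`SelfSimilarLiouville.lean`, discharging the named fact
`Literature.Analysis.FluidPDE.leiZhangZhao2017_liouville_swirl_decay` recorded there:

* `leiZhangZhao2017_liouville_swirl_decay_holds : leiZhangZhao2017_liouville_swirl_decay` — every
  bounded ancient mild solution of Navier–Stokes (`ν = 1`) on `ℝ³ × (−∞, 0)` in the tree's duality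
  form, with measurable and (pointwise) axisymmetric slices, whose swirl `Γ = x₀u₁ − x₁u₀ = r u_θ`
  tends to `0` as `r → ∞` uniformly in `z` and `t`, is on every slice `t < 0` a.e. equal to an
  axial constant `β e_z`.

Source: Z. Lei, Q. S. Zhang, N. Zhao, *Improved Liouville theorems for axially symmetric
Navier–Stokes equations*, arXiv:1701.00868 = Sci. Sin. Math. 47 (2017), **Remark 1.4** (arXiv
p. 4: "If `lim_{r→∞} Γ = 0` uniformly, the conclusion in Theorem 1.3 still holds") — the content
of **Lemma 5.2** (pp. 11–12), whose proof uses of Lemma 5.1 only its conclusion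
"`lim_{r→∞} Γ = 0` uniformly for `t` and `z`", followed by KNSS 2009, Theorem 5.2.

## The printed proof and how it is followed

Lemma 5.2 (arXiv pp. 11–12): `Γ = r v_θ` solves `∂ₜΓ + b·∇Γ + (2/r)∂ᵣΓ − ΔΓ = 0`
(`b = v_r e_r + v_z e_z`), and `Γ = 0` on the axis. Suppose `M = sup Γ > 0`. *Case 1*, `M` is
attained at some `(x₀, t₀)` (necessarily off the axis): the strong maximum principle off the axis
gives `Γ ≡ M` there, contradicting `Γ = 0` on the axis and the continuity of `Γ`. *Case 2*, `M`
is approached along `(x_k, t_k)` with `|x_k| → ∞` or `t_k → −∞`: by the uniform radial decay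
`|x'_k| ≤ C`; translating, `v_k(y, s) = v(x_k + y, t_k + s)`, and passing to a limit solution
(KNSS 2009, Lemma 6.1) one is back in Case 1. Hence `M = 0`, likewise `inf Γ = 0`, so `Γ ≡ 0`,
`v_θ ≡ 0`, and KNSS 2009, Theorem 5.2 concludes.

This file follows that architecture with one deliberate shortcut, everything else being the
tree's (proved) KNSS machinery:

1. **The linear core** `swirlDecay_sup_nonpos` / `swirlDecay_eq_zero` (Lemma 5.2 up to "`Γ ≡ 0`"):
   for a smooth scalar `f` with `|f| ≤ C_g r` (the quantitative form of "`Γ = 0` on the axis",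
   `|Γ| ≤ r ‖v‖_∞`), radially decaying uniformly in `(z, t)`, solving the swirl equation with a
   bounded measurable drift off the axis, `f ≡ 0`. *Shortcut:* both printed cases are handled at
   once by the **stability form of the strong maximum principle**, KNSS 2009, Lemma 2.1
   (`KNSS2009_lemma21`, proved in the tree: `KNSS2009_lemma21_holds`), whose `δ` is uniform in the
   drift bound — applied to a `(z, t)`-translate of `f` (`swirlDecay_translate_lemma21_data`, the
   translation of Case 2) on an annular cylinder `{a < r < R₀ + 1, |z| < 1}` reaching radius `a`
   with `3a C_g < M/2`: a near-maximum value `> M − M'δ` at radius in `[2a, R₀]` forces `f ≥ M/2`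
   down to radius `2a`, where `|f| ≤ 3a C_g < M/2`. This replaces the compactness argument
   (Lemma 6.1) of Case 2 and the qualitative strong maximum principle of Case 1; no rescaling and
   none of the cut-off argument (5.15)–(5.20) of KNSS's Theorem 5.3 (`KNSSSwirlSupNonpos`) is
   needed, because here the near-maximum radii stay bounded.
2. **Lemma 5.2 for KNSS's bounded weak solutions** `leiZhangZhao2017_ae_swirl_free`: by KNSS's §4
   regularity with the swirl equation (5.10) for the axisymmetric representative
   (`KNSS2009_regularity_axisymmetric_swirl_holds`), `u = U + β(t) e_z` a.e. with `Γ_U` in the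
   class of item 1 (drift `U + β e_z`, bounded; `|Γ_U| ≤ r‖U + βe_z‖`); the `L^∞` decay hypothesis
   transfers to the continuous `Γ_U`; so `Γ_U ≡ 0` and `swirl (u t) = 0` a.e. for a.e. `t` — the
   analogue of the tree's `KNSS2009_thm53_ae_swirl_free`.
3. **"According to Theorem 5.2 in [KNSS], `v` must be a constant"**, in the duality-form class:
   `leiZhangZhao2017_liouville_swirl_decay_holds` repeats verbatim the class bridge of
   `knss_axisymmetric_no_swirl_of_KNSS2009` (`KNSSThm52SliceBridge`: jointly measurable
   modification modulo an axial drift, measurable substitute of the drift, drift lemma), feeds the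
   resulting bounded weak solution `ũ` — whose swirl is that of `u` up to null sets — to item 2 and
   to Theorem 5.2 as printed (`KNSS2009_liouville_axisymmetric_no_swirl_holds`), and upgrades
   "a.e. `t`" to every `t < 0` by the continuity of the solenoidal pairings
   (`IsBoundedAncientMildSolution.exists_ae_eq_const_slice`).

## Mathlib / tree search

Everything used is in the tree: `KNSS2009_lemma21(_holds)` (`KNSSSwirlLiouville`,
`KNSSLemma21Proof`), `annCyl`, `annCylClosed`, `isConnected_annCyl`, … (`KNSSSwirlSupNonpos`),
`stPull`, `fderiv_stPull`, `laplacian_stPull`, `uncurry_stPull`, `measurable_stAffine`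
(`SpaceTimeRescaling`), `eR_smul_eZ_add_smul`, `laplacian_add_const`, `norm_eR_le_one`,
`measurable_eR` (`KNSSSwirlTransport`), `fderiv_swirl_apply`, `laplacian_swirl`, `contDiff_swirl`
(`SwirlTransportProofs`), `abs_swirl_le_cylRadius_mul_norm_add_smul_eZ`,
`continuousOn_iteratedFDeriv_of_lipschitz` (`KNSSSwirlLiouville`),
`SereginSverak2009.forall_le_of_ae_le_of_continuousOn`, `SereginSverak2009.cylRadius_smul_eZ_add`
(`SereginSverakBlowupSelection`), `swirl_add_smul_eZ` and the bridge lemmas of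
`AncientMildModification`, `AncientMildDrift`, `KNSSThm52SliceBridge`, and the discharges
`KNSS2009_regularity_axisymmetric_swirl_holds`, `KNSS2009_liouville_axisymmetric_no_swirl_holds`
(`KNSSThm53OfWindow`). `lean search 'leiZhangZhao2017_liouville_swirl_decay|swirlDecay'`: nothing
prior besides the fact and its sanity implications in `SelfSimilarLiouville`.

## References

* Z. Lei, Q. S. Zhang, N. Zhao, *Improved Liouville theorems for axially symmetric Navier–Stokes
  equations*, arXiv:1701.00868 = Sci. Sin. Math. 47 (2017), doi:10.1360/N012016-00149: Theorem
  1.3 and Remark 1.4 (arXiv p. 4); §5, Lemmas 5.1–5.2 and the proof of Lemma 5.2 (pp. 10–12).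
  [LeiZhangZhao2017]
* G. Koch, N. Nadirashvili, G. Seregin, V. Šverák, *Liouville theorems for the Navier–Stokes
  equations and applications*, Acta Math. 203 (2009) 83–105 = arXiv:0709.3599: Lemma 2.1 (p. 5),
  §4 (p. 8), Theorem 5.2 (pp. 9–10), (5.10) and the proof of Theorem 5.3 (p. 10), Lemma 6.1
  (p. 11). [KochNadirashviliSereginSverak2009]
-/

noncomputable section

open MeasureTheory Set Function Filter Topology TopologicalSpace InnerProductSpace
open scoped RealInnerProductSpace NNReal ENNReal ContDiff Laplacian

namespace Literature.Analysis.FluidPDE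

/-! ### The data of Lemma 2.1 for a translate of the swirl equation with bounded drift -/

/-- **The hypotheses of KNSS's Lemma 2.1 for a space–time translate of the swirl equation with a
bounded drift, on a region away from the axis** (Lei–Zhang–Zhao 2017, proof of Lemma 5.2, Case 2,
arXiv:1701.00868 pp. 11–12: the equation `∂ₜΓ + b·∇Γ + (2/r)∂ᵣΓ − ΔΓ = 0` is invariant under
translations along the axis and in time, `v_k(y, s) = v(x_k + y, t_k + s)`; the analogue of the
tree's `IsKNSSSwirlPair.rescale`/`IsKNSSSwirlPair.lemma21_data` with scaling factor `1` and the
drift bound `‖u‖ ≤ C_u` in place of `r‖u‖ ≤ C_u`). For `f`, `u` on `t < 0` with smooth slices,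
`∇f`, `Δf` jointly continuous, `u` jointly measurable with `‖u‖ ≤ C_u`, and the swirl equation off
the axis in time-integrated form; for `t₁ + T < 0`, `z̄`, a constant `m` and `Ω ⊆ {r > a}`, `a > 0`:
the translates `F(s, y) = f(t₁ + s, z̄e_z + y)`, `V(s, y) = u(t₁ + s, z̄e_z + y)` (the tree's
`stPull 1 1 t₁ (z̄ e_z)`) satisfy — the merged drift `V + (2/r)e_r` is jointly measurable and bounded
by `C_u + 2/a` on `(0, T] × Ω`, and `g = F + m` is in the elementary solution class of
`KNSS2009_lemma21` on `(0, T] × Ω` with that drift. [cite: LeiZhangZhao2017, proof of Lemma 5.2, Case 2 (arXiv pp. 11–12)] -/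
theorem swirlDecay_translate_lemma21_data {f : ℝ → (EuclideanSpace ℝ (Fin 3)) → ℝ} {u : ℝ → (EuclideanSpace ℝ (Fin 3)) → (EuclideanSpace ℝ (Fin 3))} {Cu : ℝ}
    (h1 : ∀ t < 0, ContDiff ℝ ∞ (f t))
    (h2 : ContinuousOn (fun p : ℝ × (EuclideanSpace ℝ (Fin 3)) => fderiv ℝ (f p.1) p.2) (Iio 0 ×ˢ univ))
    (h3 : ContinuousOn (fun p : ℝ × (EuclideanSpace ℝ (Fin 3)) => (Δ (f p.1)) p.2) (Iio 0 ×ˢ univ))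
    (h6 : Measurable (uncurry u))
    (h7 : ∀ t < 0, ∀ x, ‖u t x‖ ≤ Cu)
    (h8 : ∀ x, cylRadius x ≠ 0 → ∀ s t : ℝ, s ≤ t → t < 0 →
      f t x - f s x = ∫ τ in s..t, ((Δ (f τ)) x - fderiv ℝ (f τ) x (u τ x) -
        2 / cylRadius x * partialDeriv (eR x) (f τ) x))
    {t₁ zbar T a : ℝ} (hT : t₁ + T < 0) (ha : 0 < a) (m : ℝ) {Ω : Set (EuclideanSpace ℝ (Fin 3))}
    (hΩ : ∀ y ∈ Ω, a < cylRadius y) :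
    Measurable (uncurry fun s y => stPull 1 1 t₁ (zbar • eZ) u s y + (2 / cylRadius y) • eR y) ∧
    (∀ s ∈ Ioc 0 T, ∀ y ∈ Ω,
      ‖stPull 1 1 t₁ (zbar • eZ) u s y + (2 / cylRadius y) • eR y‖ ≤ Cu + 2 / a) ∧
    (∀ s ∈ Ioc 0 T, ContDiffOn ℝ 2 (fun y => stPull 1 1 t₁ (zbar • eZ) f s y + m) Ω) ∧
    ContinuousOn (fun p : ℝ × (EuclideanSpace ℝ (Fin 3)) => fderiv ℝ (fun y => stPull 1 1 t₁ (zbar • eZ) f p.1 y + m) p.2)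
      (Ioc 0 T ×ˢ Ω) ∧
    ContinuousOn (fun p : ℝ × (EuclideanSpace ℝ (Fin 3)) => (Δ fun y => stPull 1 1 t₁ (zbar • eZ) f p.1 y + m) p.2)
      (Ioc 0 T ×ˢ Ω) ∧
    (∀ y ∈ Ω, ∀ s t : ℝ, 0 < s → s ≤ t → t ≤ T →
      (stPull 1 1 t₁ (zbar • eZ) f t y + m) - (stPull 1 1 t₁ (zbar • eZ) f s y + m) =
        ∫ r in s..t, ((Δ fun y => stPull 1 1 t₁ (zbar • eZ) f r y + m) y -
          fderiv ℝ (fun y => stPull 1 1 t₁ (zbar • eZ) f r y + m) y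
            (stPull 1 1 t₁ (zbar • eZ) u r y + (2 / cylRadius y) • eR y))) := by
  have hτ : ∀ s ∈ Ioc (0 : ℝ) T, t₁ + 1 * s < 0 := fun s hs => by linarith [hs.2]
  have hΦc : Continuous fun p : ℝ × (EuclideanSpace ℝ (Fin 3)) => (t₁ + 1 * p.1, zbar • eZ + (1 : ℝ) • p.2) := by fun_prop
  have hΦmaps : MapsTo (fun p : ℝ × (EuclideanSpace ℝ (Fin 3)) => (t₁ + 1 * p.1, zbar • eZ + (1 : ℝ) • p.2))
      (Ioc 0 T ×ˢ Ω) (Iio 0 ×ˢ univ) := fun p hp => ⟨hτ p.1 hp.1, mem_univ _⟩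
  have hsub : ∀ p ∈ Ioc (0 : ℝ) T ×ˢ Ω, t₁ + 1 * p.1 < 0 := fun p hp => hτ p.1 hp.1
  have hX : ∀ y : (EuclideanSpace ℝ (Fin 3)), cylRadius (zbar • eZ + (1 : ℝ) • y) = cylRadius y := fun y => by
    rw [one_smul, SereginSverak2009.cylRadius_smul_eZ_add]
  have heRX : ∀ y : (EuclideanSpace ℝ (Fin 3)), eR (zbar • eZ + (1 : ℝ) • y) = eR y := fun y =>
    eR_smul_eZ_add_smul zbar one_pos y
  have hslice2 : ∀ σ : ℝ, t₁ + 1 * σ < 0 → ContDiff ℝ 2 (stPull 1 1 t₁ (zbar • eZ) f σ) := by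
    intro σ hσ
    have hf : ContDiff ℝ 2 (f (t₁ + 1 * σ)) := (h1 _ hσ).of_le (by norm_cast)
    exact hf.comp (contDiff_const.add (contDiff_const_smul (1 : ℝ)))
  refine ⟨?_, ?_, ?_, ?_, ?_, ?_⟩
  · -- measurability of the merged drift
    have hV : Measurable (uncurry (stPull 1 1 t₁ (zbar • eZ) u)) := by
      rw [uncurry_stPull]
      exact h6.comp (measurable_stAffine _ _ _ _)
    have h1' : Measurable fun p : ℝ × (EuclideanSpace ℝ (Fin 3)) => (2 / cylRadius p.2) • eR p.2 :=
      ((measurable_const.div continuous_cylRadius.measurable).comp measurable_snd).smul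
        (measurable_eR.comp measurable_snd)
    exact hV.add h1'
  · -- the drift bound on `Ω`
    intro s hs y hy
    have hr := hΩ y hy
    have hr0 : 0 < cylRadius y := ha.trans hr
    have hV : ‖stPull 1 1 t₁ (zbar • eZ) u s y‖ ≤ Cu := by
      rw [stPull_apply]
      exact h7 _ (hτ s hs) _
    have hE : ‖(2 / cylRadius y) • eR y‖ ≤ 2 / a := by
      rw [norm_smul, Real.norm_eq_abs, abs_of_nonneg (by positivity)]
      calc 2 / cylRadius y * ‖eR y‖ ≤ 2 / cylRadius y * 1 := by
            gcongr
            exact norm_eR_le_one y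
        _ ≤ 2 / a := by
            rw [mul_one]
            exact div_le_div_of_nonneg_left (by norm_num) ha hr.le
    exact (norm_add_le _ _).trans (add_le_add hV hE)
  · -- `C²` slices
    intro s hs
    exact ((hslice2 s (hτ s hs)).add contDiff_const).contDiffOn
  · -- `∇g = ∇F`, a translate of `∇f`
    have hc := h2.comp hΦc.continuousOn hΦmaps
    refine hc.congr fun p _ => ?_
    simp only [comp_apply]
    rw [fderiv_add_const, fderiv_stPull, one_smul]
  · -- `Δg = ΔF`, a translate of `Δf`
    have hc := h3.comp hΦc.continuousOn hΦmaps
    refine hc.congr fun p hp => ?_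
    have hf2 : ContDiff ℝ 2 (f (t₁ + 1 * p.1)) := (h1 _ (hsub p hp)).of_le (by norm_cast)
    simp only [comp_apply]
    rw [laplacian_add_const (hslice2 p.1 (hsub p hp)).contDiffAt m,
      laplacian_stPull 1 1 t₁ (zbar • eZ) f p.1 p.2 hf2, one_pow, one_smul]
  · -- the equation with the merged drift: translate (5.10) and substitute `τ = t₁ + σ`
    intro y hy s t hs hst htT
    have hr := hΩ y hy
    have hy0 : cylRadius y ≠ 0 := (ha.trans hr).ne'
    have hyX : cylRadius (zbar • eZ + (1 : ℝ) • y) ≠ 0 := by rw [hX]; exact hy0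
    have ht0 : t₁ + 1 * t < 0 := by linarith
    set X : (EuclideanSpace ℝ (Fin 3)) := zbar • eZ + (1 : ℝ) • y with hXdef
    set G : ℝ → ℝ := fun τ' => (Δ (f τ')) X - fderiv ℝ (f τ') X (u τ' X) -
      2 / cylRadius X * partialDeriv (eR X) (f τ') X with hG
    have hsrc : f (t₁ + 1 * t) X - f (t₁ + 1 * s) X = ∫ τ' in (t₁ + 1 * s)..(t₁ + 1 * t), G τ' :=
      h8 X hyX (t₁ + 1 * s) (t₁ + 1 * t) (by linarith) ht0
    have hint : EqOn (fun σ => (Δ fun y => stPull 1 1 t₁ (zbar • eZ) f σ y + m) y -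
        fderiv ℝ (fun y => stPull 1 1 t₁ (zbar • eZ) f σ y + m) y
          (stPull 1 1 t₁ (zbar • eZ) u σ y + (2 / cylRadius y) • eR y))
        (fun σ => G (t₁ + 1 * σ)) (uIcc s t) := by
      intro σ hσ
      rw [uIcc_of_le hst] at hσ
      have hσ' : t₁ + 1 * σ < 0 := by linarith [hσ.2]
      have hf2 : ContDiff ℝ 2 (f (t₁ + 1 * σ)) := (h1 _ hσ').of_le (by norm_cast)
      simp only [hG]
      rw [laplacian_add_const (hslice2 σ hσ').contDiffAt m, fderiv_add_const,
        laplacian_stPull 1 1 t₁ (zbar • eZ) f σ y hf2, fderiv_stPull, stPull_apply,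
        partialDeriv_apply]
      rw [← hXdef, heRX y, hX y]
      simp only [one_pow, one_smul, map_add, map_smul, smul_eq_mul]
      ring
    have hlhs : stPull 1 1 t₁ (zbar • eZ) f t y + m - (stPull 1 1 t₁ (zbar • eZ) f s y + m) =
        f (t₁ + 1 * t) X - f (t₁ + 1 * s) X := by
      simp only [stPull_apply]
      ring
    rw [hlhs, hsrc, intervalIntegral.integral_congr hint,
      ← intervalIntegral.smul_integral_comp_add_mul G 1 t₁, one_smul]


/-! ### The core of Lemma 5.2: a radially decaying solution of the swirl equation has `sup ≤ 0` -/

/-- **Lei–Zhang–Zhao 2017, Lemma 5.2, the maximum-principle core** (arXiv:1701.00868, proof of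
Lemma 5.2, pp. 11–12: "Since `Γ = r v_θ`, we have `Γ|_{r=0} = 0`. We are going to use a
contradiction argument and maximum principle to prove `Γ ≡ 0`. Suppose `M = sup Γ > 0` … Case 1
[`M` attained]: … `Γ ≡ M` on `(ℝ³∖{r=0}) × (−∞,0)`, which induces a contradiction with `Γ ≡ 0`
on `{r = 0}` … Case 2 [`M` approached as `|x| → ∞` or `t → −∞`]: … we know from Lemma 5.1 that
`lim_{r→∞} |Γ| = 0` holds uniformly for `t` and `x₃`. Thus we can assume that `|x'_k| ≤ C` …
`v_k(y,s) = v(x_k + y, t_k + s)` … strong maximum principle … Similar to Case 1, we get the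
contradiction"). **Statement (the linear content).** Let `f : ℝ³ × (−∞, 0) → ℝ` and a drift
`u` satisfy: `f(t, ·)` smooth with `∇f`, `Δf` jointly continuous; `|f(t, x)| ≤ C_g r(x)` (so
`f = 0` on the axis, quantitatively — for the swirl, `|Γ| ≤ r ‖v‖_∞`); `f → 0` as `r → ∞`
uniformly in `z` and `t`; `u` jointly measurable and bounded, `‖u‖ ≤ C_u`; and the swirl equation
`fₜ + u·∇f + (2/r) ∂ᵣf = Δf` off the axis, in time-integrated form. Then `f ≤ 0`. **Proof.** Both
printed cases are covered at once by the *stability form* of the strong maximum principle, KNSS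
2009, Lemma 2.1 (`KNSS2009_lemma21`, a theorem of the tree: `KNSS2009_lemma21_holds`), whose `δ`
is uniform in the drift bound, in place of the compactness argument (KNSS's Lemma 6.1) of Case 2:
if `M = sup f > 0`, the near-maximum points have radius in `(M/(2C_g), R₀)` (`R₀` the decay
radius for `M/4`); translating such a point with `f > M − min(M'δ, M/2)` (`M' = M + sup|f|`) to
`(T, y₀)`, `T = 2`, `y₀ ∈ K = {2a ≤ r ≤ R₀, |z| ≤ 1/4}`, Lemma 2.1 on the annular cylinder
`Ω = {a < r < R₀ + 1, |z| < 1}` (drift `u + (2/r)e_r` bounded by `C_u + 2/a`) applied to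
`g = F + sup|f| ≥ 0` gives `F ≥ M/2` on `{2a < r < R₀ + 1/2, |z| < 1/2} × (1, 2)`, whereas
`|F| ≤ 3a C_g < M/2` at radius `3a`, `a = min(M/(8C_g), 1/8)` — a contradiction. (No rescaling
and no cut-off argument are needed, unlike KNSS's Theorem 5.3, because the near-maximum radii
stay bounded.) [cite: LeiZhangZhao2017, Lemma 5.2 and its proof (arXiv pp. 11–12); KochNadirashviliSereginSverak2009, Lemma 2.1 (arXiv p. 5)] -/
theorem swirlDecay_sup_nonpos (hL21 : KNSS2009_lemma21 (EuclideanSpace ℝ (Fin 3)))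
    {f : ℝ → (EuclideanSpace ℝ (Fin 3)) → ℝ} {u : ℝ → (EuclideanSpace ℝ (Fin 3)) → (EuclideanSpace ℝ (Fin 3))} {Cg Cu : ℝ}
    (h1 : ∀ t < 0, ContDiff ℝ ∞ (f t))
    (h2 : ContinuousOn (fun p : ℝ × (EuclideanSpace ℝ (Fin 3)) => fderiv ℝ (f p.1) p.2) (Iio 0 ×ˢ univ))
    (h3 : ContinuousOn (fun p : ℝ × (EuclideanSpace ℝ (Fin 3)) => (Δ (f p.1)) p.2) (Iio 0 ×ˢ univ))
    (h4 : ∀ t < 0, ∀ x, |f t x| ≤ Cg * cylRadius x)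
    (h5 : ∀ ε > 0, ∃ R : ℝ, ∀ t < 0, ∀ x, R ≤ cylRadius x → |f t x| ≤ ε)
    (h6 : Measurable (uncurry u))
    (h7 : ∀ t < 0, ∀ x, ‖u t x‖ ≤ Cu)
    (h8 : ∀ x, cylRadius x ≠ 0 → ∀ s t : ℝ, s ≤ t → t < 0 →
      f t x - f s x = ∫ τ in s..t, ((Δ (f τ)) x - fderiv ℝ (f τ) x (u τ x) -
        2 / cylRadius x * partialDeriv (eR x) (f τ) x)) :
    ∀ t < 0, ∀ x, f t x ≤ 0 := by
  intro t₀ ht₀ x₀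
  by_contra hpos
  push Not at hpos
  -- `C_g > 0`
  have hCg : 0 < Cg := by
    by_contra hle
    push Not at hle
    have h := h4 t₀ ht₀ x₀
    have : Cg * cylRadius x₀ ≤ 0 := mul_nonpos_of_nonpos_of_nonneg hle (cylRadius_nonneg _)
    linarith [le_abs_self (f t₀ x₀)]
  -- `f` is bounded: `|f| ≤ C_f`
  obtain ⟨R₂, hR₂⟩ := h5 1 one_pos
  set Cf : ℝ := max (Cg * max R₂ 0) 1 with hCf_def
  have hCf : ∀ t < 0, ∀ x, |f t x| ≤ Cf := by
    intro t ht x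
    by_cases hx : R₂ ≤ cylRadius x
    · exact (hR₂ t ht x hx).trans (le_max_right _ _)
    · push Not at hx
      have h := h4 t ht x
      have : Cg * cylRadius x ≤ Cg * max R₂ 0 :=
        mul_le_mul_of_nonneg_left (hx.le.trans (le_max_left _ _)) hCg.le
      exact (h.trans this).trans (le_max_left _ _)
  have hCf0 : 0 ≤ Cf := le_trans zero_le_one (le_max_right _ _)
  -- the supremum `M`
  set S : Set ℝ := {v | ∃ t < 0, ∃ x, f t x = v} with hS_def
  have hbdd : BddAbove S := ⟨Cf, by
    rintro v ⟨t, ht, x, rfl⟩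
    exact (le_abs_self _).trans (hCf t ht x)⟩
  have hne : S.Nonempty := ⟨f t₀ x₀, t₀, ht₀, x₀, rfl⟩
  set M : ℝ := sSup S with hM_def
  have hM : 0 < M := lt_of_lt_of_le hpos (le_csSup hbdd ⟨t₀, ht₀, x₀, rfl⟩)
  have hfM : ∀ t < 0, ∀ x, f t x ≤ M := fun t ht x => le_csSup hbdd ⟨t, ht, x, rfl⟩
  have happr : ∀ η > 0, ∃ t < 0, ∃ x, M - η < f t x := by
    intro η hη
    obtain ⟨v, ⟨t, ht, x, rfl⟩, hv⟩ := exists_lt_of_lt_csSup hne (by linarith : M - η < M)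
    exact ⟨t, ht, x, hv⟩
  -- the decay radius for `M / 4`
  obtain ⟨R₀, hR₀⟩ := h5 (M / 4) (by positivity)
  set R₁ : ℝ := max R₀ 1 with hR₁_def
  have hR₁1 : 1 ≤ R₁ := le_max_right _ _
  have hR₀₁ : R₀ ≤ R₁ := le_max_left _ _
  -- the inner radius `a`
  set a : ℝ := min (M / (8 * Cg)) (1 / 8) with ha_def
  have ha : 0 < a := lt_min (by positivity) (by norm_num)
  have ha8 : a ≤ 1 / 8 := min_le_right _ _
  have haM : a ≤ M / (8 * Cg) := min_le_left _ _
  have h3a : 3 * a * Cg < M / 2 := by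
    have h1' : a * Cg ≤ M / 8 := by
      have := (le_div_iff₀ (by positivity : (0 : ℝ) < 8 * Cg)).1 haM
      linarith
    linarith
  -- the configuration of Lemma 2.1
  set Ω : Set (EuclideanSpace ℝ (Fin 3)) := annCyl a (R₁ + 1) 1 with hΩ_def
  set Ω' : Set (EuclideanSpace ℝ (Fin 3)) := annCyl (2 * a) (R₁ + 1 / 2) (1 / 2) with hΩ'_def
  set K : Set (EuclideanSpace ℝ (Fin 3)) := annCylClosed (2 * a) R₁ (1 / 4) with hK_def
  have hΩo : IsOpen Ω := isOpen_annCyl _ _ _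
  have hΩb : Bornology.IsBounded Ω := isBounded_annCyl _ _ _
  have hΩc : IsConnected Ω := isConnected_annCyl ha.le (by linarith) one_pos
  have hcl : closure Ω' ⊆ Ω :=
    (closure_annCyl_subset _ _ _).trans (annCylClosed_subset_annCyl (by linarith) (by linarith)
      (by norm_num))
  have hKc : IsCompact K := isCompact_annCylClosed _ _ _
  have hKΩ : K ⊆ Ω := annCylClosed_subset_annCyl (by linarith) (by linarith) (by norm_num)
  have hΩr : ∀ y ∈ Ω, a < cylRadius y := fun y hy => hy.1
  set M' : ℝ := M + Cf with hM'_def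
  have hM'pos : 0 < M' := by positivity
  obtain ⟨δ, hδ, hP⟩ := hL21 (T := 2) (A := Cu + 2 / a) hΩo hΩb hΩc hcl hKc hKΩ one_pos
    (by positivity : 0 < M / 2 / M')
  -- a near-maximum point
  set η : ℝ := min (M' * δ) (M / 2) with hη_def
  have hηpos : 0 < η := lt_min (by positivity) (by positivity)
  obtain ⟨tstar, htstar, xstar, hnear⟩ := happr η hηpos
  have hnear2 : M / 2 < f tstar xstar := by
    have : η ≤ M / 2 := min_le_right _ _
    linarith
  have hnearδ : M' - M' * δ < f tstar xstar + Cf := by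
    have : η ≤ M' * δ := min_le_left _ _
    linarith
  -- its radius lies in `[2a, R₁]`
  set rstar : ℝ := cylRadius xstar with hrstar_def
  have hrlow : 2 * a ≤ rstar := by
    have h := h4 tstar htstar xstar
    have hlt : M / 2 < Cg * rstar := lt_of_lt_of_le hnear2 ((le_abs_self _).trans h)
    have h2a : 2 * a ≤ M / (4 * Cg) := by
      rw [le_div_iff₀ (by positivity : (0 : ℝ) < 4 * Cg)]
      have := (le_div_iff₀ (by positivity : (0 : ℝ) < 8 * Cg)).1 haM
      linarith
    refine h2a.trans ?_
    rw [div_le_iff₀ (by positivity : (0 : ℝ) < 4 * Cg)]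
    linarith
  have hrpos : 0 < rstar := lt_of_lt_of_le (by positivity) hrlow
  have hrup : rstar ≤ R₁ := by
    by_contra hlt
    push Not at hlt
    have h := hR₀ tstar htstar xstar (hR₀₁.trans hlt.le)
    linarith [le_abs_self (f tstar xstar)]
  -- the translation: `z̄ = (x*)₂`, `t₁ = t* − 2`, `y₀ = x* − z̄ e_z ∈ K`
  set zbar : ℝ := xstar 2 with hzbar_def
  set t₁ : ℝ := tstar - 2 with ht₁_def
  set y₀ : (EuclideanSpace ℝ (Fin 3)) := (-zbar) • eZ + xstar with hy₀_def
  have hy₀r : cylRadius y₀ = rstar := by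
    rw [hy₀_def, SereginSverak2009.cylRadius_smul_eZ_add]
  have hy₀z : y₀ 2 = 0 := by
    simp [hy₀_def, hzbar_def, eZ]
  have hy₀x : zbar • eZ + (1 : ℝ) • y₀ = xstar := by
    rw [one_smul, hy₀_def, ← add_assoc, ← add_smul, add_neg_cancel, zero_smul, zero_add]
  have hy₀K : y₀ ∈ K := by
    refine ⟨by rw [hy₀r]; exact hrlow, by rw [hy₀r]; exact hrup, ?_⟩
    rw [hy₀z, abs_zero]
    norm_num
  have hT : t₁ + 2 < 0 := by rw [ht₁_def]; linarith
  obtain ⟨hb_meas, hb_bd, hg_C2, hg_cont1, hg_cont2, hg_eq⟩ :=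
    swirlDecay_translate_lemma21_data h1 h2 h3 h6 h7 h8 (zbar := zbar) hT ha Cf hΩr
  set F := stPull 1 1 t₁ (zbar • eZ) f with hF_def
  have hFval : ∀ s y, F s y = f (t₁ + 1 * s) (zbar • eZ + (1 : ℝ) • y) := fun s y =>
    stPull_apply 1 1 t₁ (zbar • eZ) f s y
  have htime : ∀ s : ℝ, s ≤ 2 → t₁ + 1 * s < 0 := fun s hs => by rw [ht₁_def]; linarith
  -- `|g| ≤ M'` on `(0, 2] × Ω`
  have hg_bd : ∀ s ∈ Ioc (0 : ℝ) 2, ∀ y ∈ Ω, |F s y + Cf| ≤ M' := by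
    intro s hs y _
    rw [hFval]
    have hup := hfM _ (htime s hs.2) (zbar • eZ + (1 : ℝ) • y)
    have hlow := (abs_le.1 (hCf _ (htime s hs.2) (zbar • eZ + (1 : ℝ) • y))).1
    rw [abs_le]
    constructor <;> linarith
  -- the near-maximum point sits at `(2, y₀)`, `y₀ ∈ K`
  have hnear' : ∃ x ∈ K, M' * (1 - δ) ≤ F 2 x + Cf := by
    refine ⟨y₀, hy₀K, ?_⟩
    rw [hFval, hy₀x, show t₁ + 1 * 2 = tstar by rw [ht₁_def]; ring]
    linarith
  -- Lemma 2.1: `F ≥ M/2` on `Ω' × (1, 2)`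
  have key := hP hb_meas hb_bd hg_C2 hg_cont1 hg_cont2 hg_eq hM'pos hg_bd hnear'
  -- the test point at radius `3a`
  set y : (EuclideanSpace ℝ (Fin 3)) := (3 * a / rstar) • y₀ with hy_def
  have hyr : cylRadius y = 3 * a := by
    rw [hy_def, cylRadius_smul, hy₀r, abs_of_pos (by positivity)]
    field_simp
  have hyz : y 2 = 0 := by
    simp [hy_def, hy₀z]
  have hyΩ' : y ∈ Ω' := by
    refine ⟨by rw [hyr]; linarith, by rw [hyr]; linarith, ?_⟩
    rw [hyz, abs_zero]
    norm_num
  have hval := key (3 / 2) ⟨by norm_num, by norm_num⟩ y hyΩ'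
  have hcalc : M' * (1 - M / 2 / M') = M' - M / 2 := by
    field_simp
  rw [hcalc] at hval
  -- `F(3/2, y) ≥ M/2` but `|F(3/2, y)| ≤ 3a C_g < M/2`
  have hFy : F (3 / 2) y ≤ 3 * a * Cg := by
    rw [hFval]
    have h := h4 _ (htime (3 / 2) (by norm_num)) (zbar • eZ + (1 : ℝ) • y)
    rw [one_smul, SereginSverak2009.cylRadius_smul_eZ_add, hyr] at h
    have h' := (le_abs_self _).trans h
    rw [one_smul]
    linarith
  have hge : M / 2 ≤ F (3 / 2) y := by
    have : F (3 / 2) y + Cf = (fun s y => F s y + Cf) (3 / 2) y := rfl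
    linarith [hval]
  linarith

/-- **Lei–Zhang–Zhao 2017, Lemma 5.2, core: `Γ ≡ 0`** ("Combining Case 1 and Case 2, we get
`M = 0`. Similarly, we can also get `m = 0`. Hence, `Γ ≡ 0`", arXiv:1701.00868 p. 12): under the
hypotheses of `swirlDecay_sup_nonpos`, `f` vanishes identically on `t < 0`, because `−f`
satisfies the same (linear, homogeneous) hypotheses with the same drift. [cite: LeiZhangZhao2017, proof of Lemma 5.2 (arXiv p. 12)] -/
theorem swirlDecay_eq_zero (hL21 : KNSS2009_lemma21 (EuclideanSpace ℝ (Fin 3)))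
    {f : ℝ → (EuclideanSpace ℝ (Fin 3)) → ℝ} {u : ℝ → (EuclideanSpace ℝ (Fin 3)) → (EuclideanSpace ℝ (Fin 3))} {Cg Cu : ℝ}
    (h1 : ∀ t < 0, ContDiff ℝ ∞ (f t))
    (h2 : ContinuousOn (fun p : ℝ × (EuclideanSpace ℝ (Fin 3)) => fderiv ℝ (f p.1) p.2) (Iio 0 ×ˢ univ))
    (h3 : ContinuousOn (fun p : ℝ × (EuclideanSpace ℝ (Fin 3)) => (Δ (f p.1)) p.2) (Iio 0 ×ˢ univ))
    (h4 : ∀ t < 0, ∀ x, |f t x| ≤ Cg * cylRadius x)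
    (h5 : ∀ ε > 0, ∃ R : ℝ, ∀ t < 0, ∀ x, R ≤ cylRadius x → |f t x| ≤ ε)
    (h6 : Measurable (uncurry u))
    (h7 : ∀ t < 0, ∀ x, ‖u t x‖ ≤ Cu)
    (h8 : ∀ x, cylRadius x ≠ 0 → ∀ s t : ℝ, s ≤ t → t < 0 →
      f t x - f s x = ∫ τ in s..t, ((Δ (f τ)) x - fderiv ℝ (f τ) x (u τ x) -
        2 / cylRadius x * partialDeriv (eR x) (f τ) x)) :
    ∀ t < 0, ∀ x, f t x = 0 := by
  have hle : ∀ t < 0, ∀ x, f t x ≤ 0 := swirlDecay_sup_nonpos hL21 h1 h2 h3 h4 h5 h6 h7 h8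
  -- the hypotheses for `-f`
  have hneg : ∀ t, (fun x => -f t x) = -(f t) := fun t => rfl
  have h1' : ∀ t < 0, ContDiff ℝ ∞ fun x => -f t x := fun t ht => (h1 t ht).neg
  have h2' : ContinuousOn (fun p : ℝ × (EuclideanSpace ℝ (Fin 3)) => fderiv ℝ (fun x => -f p.1 x) p.2) (Iio 0 ×ˢ univ) := by
    have : (fun p : ℝ × (EuclideanSpace ℝ (Fin 3)) => fderiv ℝ (fun x => -f p.1 x) p.2) =
        fun p => -fderiv ℝ (f p.1) p.2 := funext fun p => fderiv_fun_neg
    rw [this]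
    exact h2.neg
  have h3' : ContinuousOn (fun p : ℝ × (EuclideanSpace ℝ (Fin 3)) => (Δ fun x => -f p.1 x) p.2) (Iio 0 ×ˢ univ) := by
    have : (fun p : ℝ × (EuclideanSpace ℝ (Fin 3)) => (Δ fun x => -f p.1 x) p.2) = fun p => -(Δ (f p.1)) p.2 :=
      funext fun p => by rw [hneg, InnerProductSpace.laplacian_neg]; rfl
    rw [this]
    exact h3.neg
  have h4' : ∀ t < 0, ∀ x, |(-f t x)| ≤ Cg * cylRadius x := fun t ht x => by
    rw [abs_neg]; exact h4 t ht x
  have h5' : ∀ ε > 0, ∃ R : ℝ, ∀ t < 0, ∀ x, R ≤ cylRadius x → |(-f t x)| ≤ ε := by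
    intro ε hε
    obtain ⟨R, hR⟩ := h5 ε hε
    exact ⟨R, fun t ht x hx => by rw [abs_neg]; exact hR t ht x hx⟩
  have h8' : ∀ x, cylRadius x ≠ 0 → ∀ s t : ℝ, s ≤ t → t < 0 →
      (-f t x) - (-f s x) = ∫ τ in s..t, ((Δ fun y => -f τ y) x -
        fderiv ℝ (fun y => -f τ y) x (u τ x) -
        2 / cylRadius x * partialDeriv (eR x) (fun y => -f τ y) x) := by
    intro x hx s t hst ht
    have hint : (fun τ => (Δ fun y => -f τ y) x - fderiv ℝ (fun y => -f τ y) x (u τ x) -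
        2 / cylRadius x * partialDeriv (eR x) (fun y => -f τ y) x) =
        fun τ => -((Δ (f τ)) x - fderiv ℝ (f τ) x (u τ x) -
          2 / cylRadius x * partialDeriv (eR x) (f τ) x) := by
      funext τ
      rw [partialDeriv_apply, partialDeriv_apply, hneg, InnerProductSpace.laplacian_neg,
        fderiv_neg]
      simp only [Pi.neg_apply, neg_apply]
      ring
    rw [hint, intervalIntegral.integral_neg, ← h8 x hx s t hst ht]
    ring
  have hge : ∀ t < 0, ∀ x, -f t x ≤ 0 := swirlDecay_sup_nonpos hL21 h1' h2' h3' h4' h5' h6 h7 h8'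
  intro t ht x
  have := hge t ht x
  have := hle t ht x
  linarith


/-! ### Lemma 5.2 for KNSS's bounded weak solutions: the solution is swirl-free -/

/-- **Lei–Zhang–Zhao 2017, Lemma 5.2 in KNSS's class of bounded weak solutions: a radially
decaying swirl vanishes** (arXiv:1701.00868, Lemma 5.2 with its proof, pp. 11–12: "`Γ ≡ 0` in
`(−∞, 0) × ℝ³` which implies `v_θ ≡ 0`"; the solutions are KNSS's bounded ancient solutions, which
are smooth, KNSS 2009 §4). Let `u` be a bounded weak solution of Navier–Stokes (`ν = 1`) in
`ℝ³ × (−∞, 0)` (`IsBoundedWeakNSSolutionOn (Iio 0)`, the class `L^∞(ℝ³ × (−∞, 0))` of KNSS 2009,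
§4 (ii)), axisymmetric as an `L^∞` function, whose swirl `Γ = swirl (u t) = x₀u₁ − x₁u₀ = r u_θ`
tends to `0` as `r → ∞` uniformly in `z` and `t` in the `L^∞` sense: for every `ε > 0` there is
`R` with `|Γ(t, x)| ≤ ε` for a.e. `t < 0` and a.e. `x` with `r(x) ≥ R`. Then `u` is swirl-free:
`swirl (u t) = 0` a.e., for a.e. `t < 0`. **Proof.** By KNSS's §4 regularity with the swirl
equation (5.10) for the axisymmetric representative (`KNSS2009_regularity_axisymmetric_swirl`,
proved in the tree), `u = U + β(t) e_z` a.e. with `U` smooth, bounded with bounded derivatives,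
Lipschitz in time, and `Γ_U = swirl (U t)` solving (5.10) with the bounded drift `U + β e_z` off
the axis; `|Γ_U| ≤ r ‖U + β e_z‖ ≤ (C₀ + C_β) r` (`abs_swirl_le_cylRadius_mul_norm_add_smul_eZ`);
the a.e. decay hypothesis transfers to the continuous `Γ_U` everywhere (a.e. bounds are everywhere
bounds for continuous functions, in `x` on `{r > R}` and then in `t`); so `swirlDecay_eq_zero` (the
maximum-principle core of Lemma 5.2, through KNSS's Lemma 2.1) gives `Γ_U ≡ 0`, and
`swirl (u t) = swirl (U t)` a.e. [cite: LeiZhangZhao2017, Lemma 5.2 and its proof (arXiv pp. 11–12)] -/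
theorem leiZhangZhao2017_ae_swirl_free (hreg : KNSS2009_regularity_axisymmetric_swirl)
    (hL21 : KNSS2009_lemma21 (EuclideanSpace ℝ (Fin 3))) {u : ℝ → (EuclideanSpace ℝ (Fin 3)) → (EuclideanSpace ℝ (Fin 3))}
    (hu : IsBoundedWeakNSSolutionOn (Iio 0) isOpen_Iio 1 u)
    (haxi : ∀ θ : ℝ, ∀ᵐ t ∂((volume : Measure ℝ).restrict (Iio 0)),
      (fun x => u t (rotZ θ x)) =ᵐ[volume] fun x => rotZ θ (u t x))
    (hdec : ∀ ε > 0, ∃ R : ℝ, ∀ᵐ t ∂((volume : Measure ℝ).restrict (Iio 0)),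
      ∀ᵐ x ∂(volume : Measure (EuclideanSpace ℝ (Fin 3))), R ≤ cylRadius x → |swirl (u t) x| ≤ ε) :
    ∀ᵐ t ∂((volume : Measure ℝ).restrict (Iio 0)), swirl (u t) =ᵐ[volume] (0 : (EuclideanSpace ℝ (Fin 3)) → ℝ) := by
  obtain ⟨U, β, hβm, ⟨Cβ, hCβ⟩, hUm, hrep, hsmooth, -, -, hbd, hlip, hswirlEq⟩ := hreg hu haxi
  set S : Set (ℝ × (EuclideanSpace ℝ (Fin 3))) := Iio 0 ×ˢ univ with hS
  -- smoothness of the slices in the degrees used below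
  have hU2 : ∀ t < 0, ContDiff ℝ 2 (U t) := fun t ht => (hsmooth t ht).of_le (by norm_cast)
  have hU1 : ∀ t < 0, ContDiff ℝ 1 (U t) := fun t ht => (hsmooth t ht).of_le (by norm_cast)
  have hUd : ∀ t < 0, ∀ x, DifferentiableAt ℝ (U t) x := fun t ht x =>
    ((hU1 t ht).differentiable one_ne_zero) x
  -- (4.8) ⇒ joint continuity of `U`, `∇U`, `∇²U`
  have hD : ∀ k : ℕ, ContinuousOn (fun p : ℝ × (EuclideanSpace ℝ (Fin 3)) => iteratedFDeriv ℝ k (U p.1) p.2) S := by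
    intro k
    obtain ⟨L, hL⟩ := hlip k
    exact continuousOn_iteratedFDeriv_of_lipschitz hsmooth hL
  have hUc : ContinuousOn (fun p : ℝ × (EuclideanSpace ℝ (Fin 3)) => U p.1 p.2) S := by
    have h := (ContinuousMultilinearMap.apply ℝ (fun _ : Fin 0 => (EuclideanSpace ℝ (Fin 3))) (EuclideanSpace ℝ (Fin 3))
      (Fin.elim0 : Fin 0 → (EuclideanSpace ℝ (Fin 3)))).continuous.comp_continuousOn (hD 0)
    refine h.congr fun p _ => ?_
    simp only [comp_apply, ContinuousMultilinearMap.apply_apply, iteratedFDeriv_zero_apply]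
  have hD1c : ∀ y : (EuclideanSpace ℝ (Fin 3)), ContinuousOn (fun p : ℝ × (EuclideanSpace ℝ (Fin 3)) => fderiv ℝ (U p.1) p.2 y) S := by
    intro y
    have h := (ContinuousMultilinearMap.apply ℝ (fun _ : Fin 1 => (EuclideanSpace ℝ (Fin 3))) (EuclideanSpace ℝ (Fin 3))
      (fun _ => y)).continuous.comp_continuousOn (hD 1)
    refine h.congr fun p _ => ?_
    simp only [comp_apply, ContinuousMultilinearMap.apply_apply, iteratedFDeriv_one_apply]
  have hD2c : ∀ m : Fin 2 → (EuclideanSpace ℝ (Fin 3)),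
      ContinuousOn (fun p : ℝ × (EuclideanSpace ℝ (Fin 3)) => iteratedFDeriv ℝ 2 (U p.1) p.2 m) S := fun m =>
    (ContinuousMultilinearMap.apply ℝ (fun _ : Fin 2 => (EuclideanSpace ℝ (Fin 3))) (EuclideanSpace ℝ (Fin 3)) m).continuous.comp_continuousOn
      (hD 2)
  -- the swirl of `U` is continuous in `t` at fixed `x`, and in `x` at fixed `t`
  have hΓt : ∀ x : (EuclideanSpace ℝ (Fin 3)), ContinuousOn (fun s : ℝ => |swirl (U s) x|) (Iio 0) := by
    intro x
    have h1 : ContinuousOn (fun s : ℝ => U s x) (Iio 0) := by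
      have hc : Continuous fun s : ℝ => ((s, x) : ℝ × (EuclideanSpace ℝ (Fin 3))) := by fun_prop
      exact hUc.comp hc.continuousOn fun s hs => ⟨hs, mem_univ _⟩
    have h2 : ContinuousOn (fun s : ℝ => swirl (U s) x) (Iio 0) := by
      simp only [swirl]
      exact ((continuousOn_const.mul ((PiLp.continuous_apply 2 _ 1).comp_continuousOn h1)).sub
        (continuousOn_const.mul ((PiLp.continuous_apply 2 _ 0).comp_continuousOn h1)))
    exact h2.abs
  have hΓx : ∀ t < 0, Continuous fun x : (EuclideanSpace ℝ (Fin 3)) => |swirl (U t) x| := fun t ht =>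
    (contDiff_swirl (hsmooth t ht)).continuous.abs
  -- the bounds: `‖U‖ ≤ C₀`, `‖U + β e_z‖ ≤ C₀ + C_β`, `|Γ_U| ≤ (C₀ + C_β) r`
  obtain ⟨C₀, hC₀⟩ := hbd 0
  have hU0 : ∀ t < 0, ∀ x, ‖U t x‖ ≤ C₀ := fun t ht x => by
    rw [← norm_iteratedFDeriv_zero (𝕜 := ℝ)]; exact hC₀ t ht x
  have heZ : ‖(eZ : (EuclideanSpace ℝ (Fin 3)))‖ = 1 := by simp [eZ]
  have hdrift : ∀ t < 0, ∀ x, ‖U t x + β t • eZ‖ ≤ C₀ + Cβ := fun t ht x =>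
    (norm_add_le _ _).trans (add_le_add (hU0 t ht x)
      (by rw [norm_smul, heZ, mul_one, Real.norm_eq_abs]; exact hCβ t))
  have haxis : ∀ t < 0, ∀ x, |swirl (U t) x| ≤ (C₀ + Cβ) * cylRadius x := fun t ht x =>
    (abs_swirl_le_cylRadius_mul_norm_add_smul_eZ (U t) (β t) x).trans (by
      rw [mul_comm]
      exact mul_le_mul_of_nonneg_right (hdrift t ht x) (cylRadius_nonneg x))
  -- the decay hypothesis for the continuous representative: a.e. `t`, a.e. `x` ⇒ every `t`, `x`
  have hdecU : ∀ ε > 0, ∃ R : ℝ, ∀ t < 0, ∀ x, R ≤ cylRadius x → |swirl (U t) x| ≤ ε := by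
    intro ε hε
    obtain ⟨R, hR⟩ := hdec ε hε
    refine ⟨R + 1, fun t ht x hx => ?_⟩
    have hxR : R < cylRadius x := by linarith
    -- for a.e. `s < 0`: the bound holds at every point of the open set `{R < r}`
    have hae : ∀ᵐ s ∂((volume : Measure ℝ).restrict (Iio 0)), |swirl (U s) x| ≤ ε := by
      filter_upwards [hrep, hR, ae_restrict_mem measurableSet_Iio] with s hs hRs hsneg
      have hae' : ∀ᵐ y ∂(volume : Measure (EuclideanSpace ℝ (Fin 3))), R < cylRadius y → |swirl (U s) y| ≤ ε := by
        filter_upwards [hs, hRs] with y hy hRy hyR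
        have h := hRy hyR.le
        have e : swirl (u s) y = swirl (U s) y := by
          have : swirl (u s) y = swirl (fun y => U s y + β s • eZ) y := by simp only [swirl, hy]
          rw [this, swirl_add_smul_eZ]
        rwa [e] at h
      have hopen : IsOpen {y : (EuclideanSpace ℝ (Fin 3)) | R < cylRadius y} := isOpen_lt continuous_const continuous_cylRadius
      have h := SereginSverak2009.forall_le_of_ae_le_of_continuousOn (μ := (volume : Measure (EuclideanSpace ℝ (Fin 3))))
        hopen (hΓx s hsneg).continuousOn continuousOn_const
        ((ae_restrict_iff' hopen.measurableSet).2 hae')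
      exact h x hxR
    exact SereginSverak2009.forall_le_of_ae_le_of_continuousOn (μ := (volume : Measure ℝ))
      isOpen_Iio (hΓt x) continuousOn_const hae t ht
  -- `swirl U ≡ 0` by the maximum-principle core applied to `± swirl U`
  have hzero : ∀ t < 0, ∀ x, swirl (U t) x = 0 := by
    refine swirlDecay_eq_zero hL21 (f := fun t x => swirl (U t) x) (u := fun t x => U t x + β t • eZ)
      (fun t ht => contDiff_swirl (hsmooth t ht)) ?_ ?_ haxis hdecU ?_ hdrift hswirlEq
    · -- `∇Γ` jointly continuous: `DΓ(x)y = ⟪Jx, DU(x)y⟫ + ⟪Jy, U(x)⟫`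
      refine continuousOn_clm_apply.2 fun y => ?_
      have hG : ContinuousOn
          (fun p : ℝ × (EuclideanSpace ℝ (Fin 3)) => ⟪rotGen p.2, fderiv ℝ (U p.1) p.2 y⟫ + ⟪rotGen y, U p.1 p.2⟫) S :=
        ((rotGenL.continuous.comp continuous_snd).continuousOn.inner (hD1c y)).add
          (continuousOn_const.inner hUc)
      refine hG.congr fun p hp => ?_
      exact fderiv_swirl_apply (hUd p.1 hp.1 p.2) y
    · -- `ΔΓ` jointly continuous: `ΔΓ = ⟪Jx, ΔU⟫ + 2(∂₀U₁ − ∂₁U₀)`, `ΔU = Σᵢ D²U[eᵢ, eᵢ]`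
      classical
      set b := EuclideanSpace.basisFun (Fin 3) ℝ with hb
      have hΔU : ContinuousOn (fun p : ℝ × (EuclideanSpace ℝ (Fin 3)) => (Δ (U p.1)) p.2) S := by
        have h : ContinuousOn
            (fun p : ℝ × (EuclideanSpace ℝ (Fin 3)) => ∑ i, iteratedFDeriv ℝ 2 (U p.1) p.2 ![b i, b i]) S :=
          continuousOn_finsetSum _ fun i _ => hD2c _
        refine h.congr fun p _ => ?_
        exact congrFun (laplacian_eq_iteratedFDeriv_orthonormalBasis (U p.1) b) p.2
      have hG : ContinuousOn (fun p : ℝ × (EuclideanSpace ℝ (Fin 3)) => ⟪rotGen p.2, (Δ (U p.1)) p.2⟫ +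
          2 * (fderiv ℝ (U p.1) p.2 (EuclideanSpace.single 0 1) 1 -
            fderiv ℝ (U p.1) p.2 (EuclideanSpace.single 1 1) 0)) S :=
        ((rotGenL.continuous.comp continuous_snd).continuousOn.inner hΔU).add
          (continuousOn_const.mul
            (((PiLp.continuous_apply 2 _ 1).comp_continuousOn (hD1c _)).sub
              ((PiLp.continuous_apply 2 _ 0).comp_continuousOn (hD1c _))))
      refine hG.congr fun p hp => ?_
      exact laplacian_swirl (hU2 p.1 hp.1) p.2
    · -- the drift is jointly measurable
      show Measurable fun p : ℝ × (EuclideanSpace ℝ (Fin 3)) => U p.1 p.2 + β p.1 • eZ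
      exact hUm.add ((hβm.comp measurable_fst).smul_const eZ)
  -- transfer to `u = U + β e_z` (a.e.)
  filter_upwards [hrep, ae_restrict_mem measurableSet_Iio] with t ht htneg
  filter_upwards [ht] with x hx
  have h0 := hzero t htneg x
  have e : swirl (u t) x = swirl (fun y => U t y + β t • eZ) x := by simp only [swirl, hx]
  rw [e, swirl_add_smul_eZ]
  exact h0


/-! ### Remark 1.4 in the tree's duality-form class -/

/-- **Lei–Zhang–Zhao 2017, Remark 1.4 (`leiZhangZhao2017_liouville_swirl_decay`), PROVED**
(Z. Lei, Q. S. Zhang, N. Zhao, *Improved Liouville theorems for axially symmetric Navier–Stokes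
equations*, arXiv:1701.00868 = Sci. Sin. Math. 47 (2017), Remark 1.4, p. 4: "If `lim_{r→∞} Γ = 0`
uniformly, the conclusion in Theorem 1.3 still holds", i.e. bounded ancient mild axisymmetric
solutions with radially decaying swirl are constant; the content of Lemma 5.2, pp. 11–12, followed
by KNSS 2009, Theorem 5.2). **Proof** — the printed one, transported to the duality-form class
exactly as KNSS's Theorem 5.2 is in `knss_axisymmetric_no_swirl_of_KNSS2009` (`KNSSThm52SliceBridge`,
whose steps (1)–(4) are repeated verbatim): a bounded ancient mild solution with measurable
axisymmetric slices differs slice-wise from a jointly measurable bounded weak solution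
`ũ = w + c̃ e_z` of KNSS's class by null sets and an axial drift `(c̃ − c)(t) e_z`
(`exists_modification_sub_average`, the measurable substitute `c̃` of the axial average `c`, the
invariance of the slices under vertical translations off the honest set, and the drift lemma
`IsBoundedAncientMildSolution.add_timeConst_smul_of_ae_invariant`); the swirl does not see null sets
or axial drifts, so `ũ` has radially decaying swirl in the `L^∞` sense and is swirl-free a.e. by
Lemma 5.2 (`leiZhangZhao2017_ae_swirl_free`, with KNSS's §4 regularity
`KNSS2009_regularity_axisymmetric_swirl_holds` and Lemma 2.1 `KNSS2009_lemma21_holds`); KNSS's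
Theorem 5.2 as printed (`KNSS2009_liouville_axisymmetric_no_swirl_holds`) makes the slices of `ũ`,
hence of `u`, a.e. equal to `b(t) e_z` for a.e. `t`, and the continuity of the solenoidal pairings
upgrades this to every `t < 0` (`IsBoundedAncientMildSolution.exists_ae_eq_const_slice`), the
constant being axial (`eq_smul_eZ_of_ae_eq_const_of_isAxisymmetric`). [cite: LeiZhangZhao2017, Remark 1.4 (arXiv p. 4) with Lemma 5.2 (pp. 11–12); KochNadirashviliSereginSverak2009, Thm 5.2 (arXiv pp. 9–10)] -/
theorem leiZhangZhao2017_liouville_swirl_decay_holds : leiZhangZhao2017_liouville_swirl_decay := by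
  intro u hu hmeas haxi hdecay
  obtain ⟨M, hM'⟩ := hu.2
  have hM : ∀ t < 0, ∀ x, ‖u t x‖ ≤ M := fun t ht x => hM' t ht x
  have hM0 : 0 ≤ M := (norm_nonneg _).trans (hM (-1) (by norm_num) 0)
  have hν : (0 : ℝ) < 1 := one_pos
  -- (i) a radial weight and the axial average `c t e_z`
  obtain ⟨g, hg, hg0, hg1, hgrad⟩ := exists_radial_test_weight (E := EuclideanSpace ℝ (Fin 3))
  have hgc : Continuous g := hg.contDiff.continuous
  have hgi : Integrable g := hgc.integrable_of_hasCompactSupport hg.hasCompactSupport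
  have hgrot : ∀ y, g (rotZ Real.pi y) = g y := fun y => hgrad _ _ (norm_rotZ _ _)
  set c : ℝ → ℝ := fun t => ∫ y, g y * u t y 2 with hc_def
  have havg : ∀ t < 0, ∫ y, g y • u t y = c t • eZ := fun t ht =>
    integral_smul_eq_smul_eZ_of_isAxisymmetric hgi hgrot (haxi t ht) (hmeas t ht) (hM t ht)
  have hcb : ∀ t < 0, |c t| ≤ M := by
    intro t ht
    have hint : Integrable fun y => g y * u t y 2 :=
      Integrable.mono' (hgi.norm.mul_const M) (hgi.aestronglyMeasurable.mul
        ((EuclideanSpace.proj (2 : Fin 3)).continuous.comp_aestronglyMeasurable (hmeas t ht)))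
        (Eventually.of_forall fun y => by
          rw [norm_mul]
          refine mul_le_mul_of_nonneg_left ?_ (norm_nonneg _)
          exact (by simpa using PiLp.norm_apply_le (u t y) 2 : ‖u t y 2‖ ≤ ‖u t y‖).trans (hM t ht y))
    calc |c t| = ‖∫ y, g y * u t y 2‖ := (Real.norm_eq_abs _).symm
      _ ≤ ∫ y, ‖g y‖ * M := norm_integral_le_of_norm_le (hgi.norm.mul_const M) (Eventually.of_forall fun y => by
          rw [norm_mul]
          refine mul_le_mul_of_nonneg_left ?_ (norm_nonneg _)
          exact (by simpa using PiLp.norm_apply_le (u t y) 2 : ‖u t y 2‖ ≤ ‖u t y‖).trans (hM t ht y))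
      _ = M := by
          rw [integral_mul_const]
          have : ∫ y, ‖g y‖ = 1 := by
            rw [← hg1]
            exact integral_congr_ae (Eventually.of_forall fun y => Real.norm_of_nonneg (hg0 y))
          rw [this, one_mul]
  -- (ii) the jointly measurable modification `w`, `u t = w t + c t e_z` a.e.
  obtain ⟨w, hw, ⟨B, hwB⟩, hwu⟩ :=
    hu.exists_modification_sub_average hν hmeas hgc hg.hasCompactSupport hg1
  have hwu' : ∀ t < 0, w t =ᵐ[volume] fun x => u t x - c t • eZ := fun t ht =>
    (hwu t ht).trans (Eventually.of_forall fun x => by simp only [havg t ht])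
  have huw : ∀ t < 0, u t =ᵐ[volume] fun x => w t x + c t • eZ := fun t ht => by
    filter_upwards [hwu' t ht] with x hx
    rw [hx, sub_add_cancel]
  have hwm : ∀ t, AEStronglyMeasurable (w t) volume := fun t =>
    (hw.comp_measurable measurable_prodMk_left).aestronglyMeasurable
  have hwdiv : ∀ t < 0, IsWeaklyDivFree (w t) := fun t ht =>
    isWeaklyDivFree_of_ae_eq_add_const (hu.1.1 t ht) (hmeas t ht) (hM t ht) (-(c t • eZ))
      ((hwu' t ht).trans (Eventually.of_forall fun x => by simp only [sub_eq_add_neg]))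
  -- (iii) `u' = w + c e_z`, a.e. equal to `u` slice-wise
  set u' : ℝ → EuclideanSpace ℝ (Fin 3) → EuclideanSpace ℝ (Fin 3) := fun t x => w t x + c t • eZ with hu'_def
  have hu'u : ∀ t < 0, u' t =ᵐ[volume] u t := fun t ht => (huw t ht).symm
  have heZ : ‖(eZ : EuclideanSpace ℝ (Fin 3))‖ = 1 := by simp [eZ]
  have hu'M : ∀ t < 0, ∀ x, ‖u' t x‖ ≤ B + M := fun t ht x =>
    (norm_add_le _ _).trans (add_le_add (hwB t x) (by rw [norm_smul, heZ, mul_one, Real.norm_eq_abs]; exact hcb t ht))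
  have hu'sol : IsBoundedAncientMildSolution 1 u' := hu.congr_ae_slice hu'u ⟨B + M, fun t ht x => hu'M t ht x⟩
  have hu'meas : ∀ t < 0, AEStronglyMeasurable (u' t) volume := fun t _ => (hwm t).add aestronglyMeasurable_const
  -- (v) a countable dense family of solenoidal tests; the cross terms `m` and their zero sets
  obtain ⟨φs, hφs, hdense⟩ := exists_seq_isDivFree_dense (E := EuclideanSpace ℝ (Fin 3))
  have hm_meas : ∀ (q : ℝ) (k : ℕ), Measurable fun τ =>
      ∫ x, ⟪w τ x, fderiv ℝ (heatTest 1 (φs k) (q - τ)) x eZ⟫ := fun q k =>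
    measurable_integral_inner_fderiv_heatTest_apply hw (hφs k).1 1 q eZ
  -- honest rational final times: non-constant slices
  set H : Set ℚ := {q | (q : ℝ) < 0 ∧ ∀ κ : EuclideanSpace ℝ (Fin 3), ¬ (u q =ᵐ[volume] fun _ => κ)} with hH_def
  set A : ℚ → ℕ → Set ℝ := fun q k =>
    {τ | τ < q ∧ (∫ x, ⟪w τ x, fderiv ℝ (heatTest 1 (φs k) (q - τ)) x eZ⟫) ≠ 0} with hA_def
  have hAm : ∀ q k, MeasurableSet (A q k) := fun q k =>
    measurableSet_Iio.inter ((hm_meas q k) (measurableSet_singleton (0 : ℝ)).compl)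
  set Gd : Set ℝ := ⋃ p : H × ℕ, A p.1 p.2 with hGd_def
  have hGm : MeasurableSet Gd := MeasurableSet.iUnion fun p => hAm _ _
  have hGd0 : Gd ⊆ Iio 0 := by
    intro τ hτ
    obtain ⟨p, hp⟩ := mem_iUnion.1 hτ
    exact lt_trans hp.1 p.1.2.1
  -- (iv)+(vii) `c` is a.e. measurable on `Gd`
  have hcA : ∀ (q : H) (k : ℕ), AEMeasurable c (volume.restrict (A q k)) := by
    intro q k
    have hq0 : ((q : ℚ) : ℝ) < 0 := q.2.1
    set qr : ℝ := ((q : ℚ) : ℝ) with hqr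
    -- the three functions of `τ`
    set Gf : ℝ → ℝ := fun τ => ∫ x, ⟪u τ x, convect (u τ) (heatTest 1 (φs k) (qr - τ)) x⟫ with hGf
    set Nf : ℝ → ℝ := fun τ => ∫ x, ⟪w τ x, fderiv ℝ (heatTest 1 (φs k) (qr - τ)) x (w τ x)⟫ with hNf
    set mf : ℝ → ℝ := fun τ => ∫ x, ⟪w τ x, fderiv ℝ (heatTest 1 (φs k) (qr - τ)) x eZ⟫ with hmf
    have hNm : Measurable Nf := measurable_integral_inner_fderiv_heatTest_self hw (hφs k).1 1 qr
    have hmm : Measurable mf := hm_meas qr k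
    -- the splitting `G = N + c m` at every `τ < 0`
    have hsplit : ∀ τ < 0, Gf τ = Nf τ + c τ * mf τ := by
      intro τ hτ
      have e1 : Gf τ = ∫ x, ⟪u' τ x, convect (u' τ) (heatTest 1 (φs k) (qr - τ)) x⟫ :=
        integral_inner_convect_heatTest_congr_ae (huw τ hτ) _
      rw [e1]
      simpa only [hu'_def, hNf, hmf, convect_apply] using
        integral_inner_convect_heatTest_add_const (hwm τ) (hwB τ) (hwdiv τ hτ) (c τ) eZ (hφs k).1 1 (qr - τ)
    -- honesty at `q`: `G` is integrable on every `(s, q)`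
    have hGint : ∀ s < qr, IntervalIntegrable Gf volume s qr := fun s hs =>
      hu.intervalIntegrable_nonlinear_of_not_ae_const hν hmeas hq0 q.2.2 hs (hφs k).1 (hφs k).2
    -- `c m = G - N` is a.e. measurable on every `(s, q)`, hence on `Iio q`
    have hcm_s : ∀ s < qr, AEMeasurable (fun τ => c τ * mf τ) (volume.restrict (Ioo s qr)) := by
      intro s hs
      have hGae : AEMeasurable Gf (volume.restrict (Ioo s qr)) :=
        ((hGint s hs).def'.mono_set (by rw [uIoc_of_le hs.le]; exact Ioo_subset_Ioc_self)).aestronglyMeasurable.aemeasurable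
      refine (hGae.sub hNm.aemeasurable).congr ?_
      refine (ae_restrict_mem measurableSet_Ioo).mono fun τ hτ => ?_
      have hτ0 : τ < 0 := hτ.2.trans hq0
      show Gf τ - Nf τ = c τ * mf τ
      rw [hsplit τ hτ0]
      ring
    have hcm : AEMeasurable (fun τ => c τ * mf τ) (volume.restrict (Iio qr)) := by
      have hcover : Iio qr = ⋃ n : ℕ, Ioo (qr - ((n : ℝ) + 1)) qr := by
        ext τ
        simp only [mem_Iio, mem_iUnion, mem_Ioo]
        constructor
        · intro hτ
          obtain ⟨n, hn⟩ := exists_nat_gt (qr - τ)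
          exact ⟨n, by linarith, hτ⟩
        · rintro ⟨n, -, hn2⟩
          exact hn2
      rw [hcover]
      exact aemeasurable_iUnion_iff.2 fun n => hcm_s _ (by linarith)
    -- on `A q k`, `m ≠ 0` and `c = (c m) / m`
    have hAsub : A q k ⊆ Iio qr := fun τ hτ => hτ.1
    have hcmA : AEMeasurable (fun τ => c τ * mf τ) (volume.restrict (A q k)) :=
      hcm.mono_measure (Measure.restrict_mono hAsub le_rfl)
    refine ((hcmA.div hmm.aemeasurable).congr ?_)
    refine (ae_restrict_mem (hAm q k)).mono fun τ hτ => ?_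
    show c τ * mf τ / mf τ = c τ
    exact mul_div_cancel_right₀ _ hτ.2
  have hcG : AEMeasurable c (volume.restrict Gd) := aemeasurable_iUnion_iff.2 fun p => hcA p.1 p.2
  -- the measurable, bounded substitute `ct` of `c`: `ct = c` a.e. on `Gd`, `ct = 0` off `Gd`
  set c₁ : ℝ → ℝ := hcG.mk c with hc₁_def
  have hc₁m : Measurable c₁ := hcG.measurable_mk
  have hcc₁ : ∀ᵐ τ ∂(volume.restrict Gd), c τ = c₁ τ := hcG.ae_eq_mk
  set ct : ℝ → ℝ := Gd.indicator fun τ => max (-M) (min M (c₁ τ)) with hct_def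
  have hctm : Measurable ct := (measurable_const.max (measurable_const.min hc₁m)).indicator hGm
  have hclip : ∀ y : ℝ, |max (-M) (min M y)| ≤ M := fun y =>
    abs_le.2 ⟨le_max_left _ _, max_le (by linarith) (min_le_left _ _)⟩
  have hctb : ∀ τ, |ct τ| ≤ M := by
    intro τ
    by_cases hτ : τ ∈ Gd
    · rw [hct_def, indicator_of_mem hτ]; exact hclip _
    · rw [hct_def, indicator_of_notMem hτ, abs_zero]; exact hM0
  have hct_on : ∀ᵐ τ ∂(volume : Measure ℝ), τ ∈ Gd → ct τ = c τ := by
    have h1 : ∀ᵐ τ ∂(volume : Measure ℝ), τ ∈ Gd → c τ = c₁ τ := (ae_restrict_iff' hGm).1 hcc₁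
    filter_upwards [h1] with τ hτ hmem
    have hc0 : |c τ| ≤ M := hcb τ (hGd0 hmem)
    rw [hct_def, indicator_of_mem hmem, ← hτ hmem]
    rw [abs_le] at hc0
    rw [min_eq_right hc0.2, max_eq_right hc0.1]
  -- (viii) off `Gd` the slices are invariant under the vertical translations
  have hinv_off : ∀ τ < 0, τ ∉ Gd → ∀ h : ℝ,
      (fun x => u τ (x + h • eZ)) =ᵐ[volume] u τ := by
    intro τ hτ hτG
    refine ae_eq_comp_add_smul_of_forall_integral_inner_fderiv_eq_zero (hmeas τ hτ) (hM τ hτ) (hu.1.1 τ hτ)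
      (fun φ hφ hdivφ => ?_)
    have hφ1 : ContDiff ℝ 1 φ := hφ.contDiff.of_le (by exact_mod_cast le_top)
    by_cases hacc : ∀ ε > (0 : ℝ), ∃ q : ℚ, q ∈ H ∧ τ < q ∧ (q : ℝ) < τ + ε
    · -- honest rational final times accumulate at `τ⁺`
      choose q hqH hτq hqε using fun n : ℕ => hacc (1 / ((n : ℝ) + 1)) (by positivity)
      have hσpos : ∀ n, 0 < (q n : ℝ) - τ := fun n => sub_pos.2 (hτq n)
      have hσ : Tendsto (fun n => (q n : ℝ) - τ) atTop (𝓝 0) := by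
        refine squeeze_zero (fun n => (hσpos n).le) (fun n => ?_) tendsto_one_div_add_atTop_nhds_zero_nat
        linarith [hqε n]
      -- `m^{qₙ}_k(τ) = 0`: otherwise `τ ∈ Gd`
      have hm0 : ∀ n k, ∫ x, ⟪w τ x, fderiv ℝ (heatTest 1 (φs k) ((q n : ℝ) - τ)) x eZ⟫ = 0 := by
        intro n k
        by_contra hne
        exact hτG (mem_iUnion.2 ⟨⟨⟨q n, hqH n⟩, k⟩, hτq n, hne⟩)
      -- transfer from `w τ` to `u τ = w τ + c τ e_z`
      have htrans : ∀ ψ : EuclideanSpace ℝ (Fin 3) → EuclideanSpace ℝ (Fin 3),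
          FunctionSpaces.IsTestFunctionOn (⊤ : Opens (EuclideanSpace ℝ (Fin 3))) ψ → ∀ σ : ℝ,
          ∫ x, ⟪u τ x, fderiv ℝ (heatTest 1 ψ σ) x eZ⟫ = ∫ x, ⟪w τ x, fderiv ℝ (heatTest 1 ψ σ) x eZ⟫ := by
        intro ψ hψ σ
        have hψ1 : ContDiff ℝ 1 ψ := hψ.contDiff.of_le (by exact_mod_cast le_top)
        have hDc : Continuous fun z => fderiv ℝ ψ z eZ := (hψ1.continuous_fderiv one_ne_zero).clm_apply continuous_const
        have hDi : Integrable fun x => fderiv ℝ (heatTest 1 ψ σ) x eZ := by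
          have : Integrable (heatFlow (fun z => fderiv ℝ ψ z eZ) (1 * σ)) :=
            integrable_heatFlow (hDc.integrable_of_hasCompactSupport (hψ.hasCompactSupport.fderiv_apply (𝕜 := ℝ) eZ)) _
          exact this.congr (Eventually.of_forall fun x => (fderiv_heatFlow_apply hψ1 hψ.hasCompactSupport _ x eZ).symm)
        have i1 : Integrable fun x => ⟪w τ x, fderiv ℝ (heatTest 1 ψ σ) x eZ⟫ :=
          integrable_inner_of_aestronglyMeasurable_of_norm_le (hwm τ) (hwB τ) hDi
        have i2 : Integrable fun x => ⟪c τ • eZ, fderiv ℝ (heatTest 1 ψ σ) x eZ⟫ := hDi.const_inner _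
        have h0 : ∫ x, ⟪c τ • eZ, fderiv ℝ (heatTest 1 ψ σ) x eZ⟫ = 0 :=
          integral_inner_const_fderiv_heatFlow_eq_zero hψ1 hψ.hasCompactSupport (1 * σ) (c τ • eZ) eZ
        calc ∫ x, ⟪u τ x, fderiv ℝ (heatTest 1 ψ σ) x eZ⟫
            = ∫ x, (⟪w τ x, fderiv ℝ (heatTest 1 ψ σ) x eZ⟫ + ⟪c τ • eZ, fderiv ℝ (heatTest 1 ψ σ) x eZ⟫) :=
              integral_congr_ae (by filter_upwards [huw τ hτ] with x hx; rw [hx, inner_add_left])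
          _ = ∫ x, ⟪w τ x, fderiv ℝ (heatTest 1 ψ σ) x eZ⟫ := by rw [integral_add i1 i2, h0, add_zero]
      have hzero_u : ∀ n k, ∫ x, ⟪u τ x, fderiv ℝ (heatTest 1 (φs k) ((q n : ℝ) - τ)) x eZ⟫ = 0 :=
        fun n k => by rw [htrans _ (hφs k).1, hm0]
      have hall : ∀ n, ∫ x, ⟪u τ x, fderiv ℝ (heatTest 1 φ ((q n : ℝ) - τ)) x eZ⟫ = 0 := fun n =>
        integral_inner_fderiv_heatTest_eq_zero_of_dense (hmeas τ hτ) (hM τ hτ) hφs hdense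
          (by simpa using hσpos n) (hzero_u n) hφ hdivφ
      exact integral_inner_fderiv_eq_zero_of_tendsto (hmeas τ hτ) (hM τ hτ) hν hσpos hσ hφ hall
    · -- the a.e.-constant rational slices accumulate at `τ⁺`: `u τ` is itself a.e. constant
      push Not at hacc
      obtain ⟨ε, hε, hfar⟩ := hacc
      have hδ : 0 < min ε (-τ) := lt_min hε (by linarith)
      -- rationals `r n ∈ (τ, τ + min ε (-τ) / (n + 2))`
      have hr : ∀ n : ℕ, ∃ r : ℚ, τ < r ∧ (r : ℝ) < τ + min ε (-τ) / ((n : ℝ) + 2) := fun n =>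
        exists_rat_btwn (lt_add_of_pos_right τ (by positivity))
      choose r hτr hrδ using hr
      have hr0 : ∀ n, (r n : ℝ) < 0 := by
        intro n
        have h1 : min ε (-τ) / ((n : ℝ) + 2) ≤ min ε (-τ) / 2 :=
          div_le_div_of_nonneg_left hδ.le (by norm_num) (by linarith [(Nat.cast_nonneg n : (0 : ℝ) ≤ n)])
        have h2 : min ε (-τ) ≤ -τ := min_le_right _ _
        linarith [hrδ n]
      have hrε : ∀ n, (r n : ℝ) < τ + ε := by
        intro n
        have h1 : min ε (-τ) / ((n : ℝ) + 2) ≤ min ε (-τ) / 1 :=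
          div_le_div_of_nonneg_left hδ.le one_pos (by linarith [(Nat.cast_nonneg n : (0 : ℝ) ≤ n)])
        have h2 : min ε (-τ) ≤ ε := min_le_left _ _
        linarith [hrδ n]
      -- these slices are a.e. constant (the `r n` are not honest)
      have hrconst : ∀ n, ∃ κ : EuclideanSpace ℝ (Fin 3), u (r n) =ᵐ[volume] fun _ => κ := by
        intro n
        by_contra hne
        push Not at hne
        have hmem : r n ∈ H := ⟨hr0 n, fun κ => hne κ⟩
        linarith [hfar (r n) hmem (hτr n), hrε n]
      have hrt : Tendsto (fun n => (r n : ℝ)) atTop (𝓝[Iio 0] τ) := by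
        refine tendsto_nhdsWithin_iff.2 ⟨?_, Eventually.of_forall hr0⟩
        have hup : Tendsto (fun n : ℕ => τ + min ε (-τ) / ((n : ℝ) + 2)) atTop (𝓝 τ) := by
          have h1 : Tendsto (fun n : ℕ => min ε (-τ) / ((n : ℝ) + 2)) atTop (𝓝 0) := by
            have := (tendsto_one_div_add_atTop_nhds_zero_nat.comp (tendsto_add_atTop_nat 1)).const_mul (min ε (-τ))
            rw [mul_zero] at this
            refine this.congr fun n => ?_
            simp only [Function.comp_apply, Nat.cast_add, Nat.cast_one]
            ring
          simpa using h1.const_add τ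
        exact tendsto_of_tendsto_of_tendsto_of_le_of_le tendsto_const_nhds hup (fun n => (hτr n).le) fun n => (hrδ n).le
      have hpair0 : ∀ θ : EuclideanSpace ℝ (Fin 3) → EuclideanSpace ℝ (Fin 3),
          FunctionSpaces.IsTestFunctionOn (⊤ : Opens (EuclideanSpace ℝ (Fin 3))) θ → VectorCalculus.IsDivFree θ →
          ∫ x, ⟪u τ x, θ x⟫ = 0 := by
        intro θ hθ hdivθ
        have hθ1 : ContDiff ℝ 1 θ := hθ.contDiff.of_le (by exact_mod_cast le_top)
        have hcont := hu.continuousOn_integral_inner hν hmeas hθ hdivθ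
        have hlim : Tendsto (fun n => ∫ x, ⟪u (r n) x, θ x⟫) atTop (𝓝 (∫ x, ⟪u τ x, θ x⟫)) :=
          (hcont τ hτ).tendsto.comp hrt
        have hvals : ∀ n, ∫ x, ⟪u (r n) x, θ x⟫ = 0 := by
          intro n
          obtain ⟨κ, hκ⟩ := hrconst n
          rw [integral_congr_ae (show (fun x => ⟪u (r n) x, θ x⟫) =ᵐ[volume] fun x => ⟪κ, θ x⟫ by
            filter_upwards [hκ] with x hx; rw [hx])]
          exact integral_inner_const_eq_zero_of_isDivFree κ hθ1 hθ.hasCompactSupport hdivθ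
        exact tendsto_nhds_unique hlim (tendsto_const_nhds.congr fun n => (hvals n).symm)
      obtain ⟨κ, hκ⟩ := IsWeaklyDivFree.exists_ae_eq_const_of_norm_le_of_forall_integral_inner_eq_zero
        (hmeas τ hτ) (hM τ hτ) (hu.1.1 τ hτ) hpair0
      have hDi : Integrable fun x => fderiv ℝ φ x eZ :=
        ((hφ1.continuous_fderiv one_ne_zero).clm_apply continuous_const).integrable_of_hasCompactSupport
          (hφ.hasCompactSupport.fderiv_apply (𝕜 := ℝ) eZ)
      calc ∫ x, ⟪u τ x, fderiv ℝ φ x eZ⟫ = ∫ x, ⟪κ, fderiv ℝ φ x eZ⟫ :=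
            integral_congr_ae (by filter_upwards [hκ] with x hx; rw [hx])
        _ = ⟪κ, ∫ x, fderiv ℝ φ x eZ⟫ := integral_inner hDi κ
        _ = 0 := by rw [integral_fderiv_apply_eq_zero hφ1 hφ.hasCompactSupport eZ, inner_zero_right]
  -- (ix) the drift lemma: `ũ = w + ct e_z = u' + (ct - c) e_z` is a bounded ancient mild solution
  set d : ℝ → ℝ := fun τ => ct τ - c τ with hd_def
  have hd : ∃ D : ℝ, ∀ t < 0, |d t| ≤ D := ⟨M + M, fun t ht =>
    (abs_sub _ _).trans (add_le_add (hctb t) (hcb t ht))⟩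
  have hinv : ∀ᵐ τ ∂((volume : Measure ℝ).restrict (Iio 0)),
      d τ = 0 ∨ ∀ h : ℝ, (fun x => u' τ (x + h • eZ)) =ᵐ[volume] u' τ := by
    filter_upwards [ae_restrict_of_ae (s := Iio (0 : ℝ)) hct_on, ae_restrict_mem measurableSet_Iio] with τ hτG hτ0
    by_cases hmem : τ ∈ Gd
    · left
      show ct τ - c τ = 0
      rw [hτG hmem, sub_self]
    · right
      intro h
      have e1 : (fun x => u' τ (x + h • eZ)) =ᵐ[volume] fun x => u τ (x + h • eZ) :=
        (measurePreserving_add_right volume (h • eZ)).quasiMeasurePreserving.ae_eq (hu'u τ hτ0)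
      exact e1.trans ((hinv_off τ hτ0 hmem h).trans (hu'u τ hτ0).symm)
  have hsol := hu'sol.add_timeConst_smul_of_ae_invariant hu'meas eZ hd hinv
  have hũ_eq : (fun t x => u' t x + d t • eZ) = fun t x => w t x + ct t • eZ := by
    funext t x
    simp only [hu'_def, hd_def, sub_smul]
    abel
  rw [hũ_eq] at hsol
  -- (x) `ũ` is a bounded weak solution, axisymmetric a.e., with radially decaying swirl
  have hũjoint : AEStronglyMeasurable (uncurry fun t x => w t x + ct t • eZ)
      ((volume : Measure (ℝ × EuclideanSpace ℝ (Fin 3))).restrict (Iio 0 ×ˢ univ)) :=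
    (hw.add ((hctm.comp measurable_fst).stronglyMeasurable.smul_const eZ)).aestronglyMeasurable
  have hũsl : ∀ t < 0, AEStronglyMeasurable (fun x => w t x + ct t • eZ) volume := fun t _ =>
    (hwm t).add aestronglyMeasurable_const
  have hweak := hsol.isBoundedWeakNSSolutionOn hν hũjoint hũsl
  have hũU : ∀ t < 0, (fun x => w t x + ct t • eZ) =ᵐ[volume] fun x => u t x + (ct t - c t) • eZ := fun t ht => by
    filter_upwards [hwu' t ht] with x hx
    rw [hx, sub_smul]
    abel
  have haxiU : ∀ t < 0, IsAxisymmetric fun x => u t x + (ct t - c t) • eZ := fun t ht =>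
    isAxisymmetric_add_smul_eZ (haxi t ht) _
  have hax : ∀ θ : ℝ, ∀ᵐ t ∂((volume : Measure ℝ).restrict (Iio 0)),
      (fun x => (fun x => w t x + ct t • eZ) (rotZ θ x)) =ᵐ[volume] fun x => rotZ θ ((fun x => w t x + ct t • eZ) x) := by
    intro θ
    filter_upwards [ae_restrict_mem measurableSet_Iio] with t ht
    have e1 : (fun x => (fun x => w t x + ct t • eZ) (rotZ θ x)) =ᵐ[volume]
        fun x => u t (rotZ θ x) + (ct t - c t) • eZ :=
      (measurePreserving_rotZ θ).quasiMeasurePreserving.ae_eq (hũU t ht)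
    have e2 : (fun x => rotZ θ ((fun x => w t x + ct t • eZ) x)) =ᵐ[volume]
        fun x => rotZ θ (u t x + (ct t - c t) • eZ) := by
      filter_upwards [hũU t ht] with x hx
      simp only [hx]
    have e3 : (fun x => u t (rotZ θ x) + (ct t - c t) • eZ) =ᵐ[volume]
        fun x => rotZ θ (u t x + (ct t - c t) • eZ) :=
      Eventually.of_forall fun x => haxiU t ht θ x
    exact e1.trans (e3.trans e2.symm)
  have hdecU : ∀ ε > 0, ∃ R : ℝ, ∀ᵐ t ∂((volume : Measure ℝ).restrict (Iio 0)),
      ∀ᵐ x ∂(volume : Measure (EuclideanSpace ℝ (Fin 3))), R ≤ cylRadius x →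
        |swirl (fun x => w t x + ct t • eZ) x| ≤ ε := by
    intro ε hε
    obtain ⟨R, hR⟩ := hdecay ε hε
    refine ⟨R, ?_⟩
    filter_upwards [ae_restrict_mem measurableSet_Iio] with t ht
    filter_upwards [hũU t ht] with x hx hxR
    have : swirl (fun x => w t x + ct t • eZ) x = swirl (fun y => u t y + (ct t - c t) • eZ) x := by
      simp only [swirl, hx]
    rw [this, swirl_add_smul_eZ]
    exact hR t ht x hxR
  have hsw : ∀ᵐ t ∂((volume : Measure ℝ).restrict (Iio 0)),
      swirl (fun x => w t x + ct t • eZ) =ᵐ[volume] (0 : EuclideanSpace ℝ (Fin 3) → ℝ) :=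
    leiZhangZhao2017_ae_swirl_free KNSS2009_regularity_axisymmetric_swirl_holds
      (KNSS2009_lemma21_holds (EuclideanSpace ℝ (Fin 3))) hweak hax hdecU
  obtain ⟨b, -, -, hb⟩ := KNSS2009_liouville_axisymmetric_no_swirl_holds hweak hax hsw
  -- the slices of `u` are a.e. constant for a.e. `t`, hence for every `t`
  have hconst : ∀ᵐ t ∂((volume : Measure ℝ).restrict (Iio 0)),
      u t =ᵐ[volume] fun _ => (b t - (ct t - c t)) • eZ := by
    filter_upwards [hb, ae_restrict_mem measurableSet_Iio] with t hbt ht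
    filter_upwards [hbt, hũU t ht] with x hx hx'
    have hx2 : w t x + ct t • eZ = b t • eZ := hx
    have e : u t x = (w t x + ct t • eZ) - (ct t - c t) • eZ := by rw [hx']; abel
    rw [e, hx2]
    simp only [sub_smul]
  intro t ht
  obtain ⟨κ, hκ⟩ := hu.exists_ae_eq_const_slice hν hmeas hconst t ht
  have hax' := eq_smul_eZ_of_ae_eq_const_of_isAxisymmetric (haxi t ht) hκ
  refine ⟨κ 2, ?_⟩
  rw [hax'] at hκ
  exact hκ

end Literature.Analysis.FluidPDE

end
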